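import Literature.Probability.LatticeModels.Correlations
import Literature.Probability.LatticeModels.IsingModel
import Literature.Probability.LatticeModels.RandomCurrents
import HarnessLib

/-!
# Ursell's four-point function as a double-current connection probability

Topic: `Literature/Probability/LatticeModels`. Item `wi-04546` (for `stmt-CriticalPhenomena-0636`):
the random-current identity for the Ursell function `U₄` of the nearest-neighbour ferromagnetic
Ising model with free boundary condition and zero field on a finite graph `G`
(Aizenman 1982; Duminil-Copin 2016, eq. (24); Aizenman–Duminil-Copin 2021, eq. (3.11)), and the
source-insertion identity (Aizenman–Duminil-Copin 2021, eq. (3.7)) it is derived from, vendored as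
named facts `def … : Prop` in the spelling of `RandomCurrents.lean` (`Current G`, `pairWeight`,
`doubleCurrentMeasure G β A B = P^A ⊗ P^B`, `tracedConn G x z = {x ⟷ z in n₁ + n₂}`) and of
`Correlations.lean` (`connectedFour μ spinAt x = U₄`, as in `Literature.Probability.LatticeModels.lebowitz`).

## Content

* `subcurrentEvent G B = {(n₁,n₂) | n₁ + n₂ ∈ 𝓕_B}` — "there exists a sub-current `m ≤ n₁ + n₂`
  with `∂m = B`" (ADC2021, Def. 3.2 (iii)).
* `isingCorr_mul_eq_doubleCurrent_subcurrent` — NAMED FACT (ADC2021 (3.7), finite volume; also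
  Duminil-Copin 2016, display after Cor. 3.4, p. 10):
  `⟨σ_A⟩⟨σ_B⟩ = ⟨σ_A σ_B⟩ · P^{A∆B,∅}[n₁ + n₂ ∈ 𝓕_B]`, `β ≥ 0`.
* `ursellFour_eq_doubleCurrent` — NAMED FACT (Duminil-Copin 2016 (24); ADC2021 (3.11);
  Aizenman 1982): for `β ≥ 0` and vertices `x y z t`,
  `U₄(x,y,z,t) = -2 ⟨σ_x σ_y⟩ ⟨σ_z σ_t⟩ · P^{xy} ⊗ P^{zt}[x ⟷ z in n₁ + n₂]`.
* Proved corollaries of the fact: `.abs_eq` / `.abs_le` (ADC2021 (3.12)-type bounds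
  `|U₄| ≤ 2 ⟨σ_xσ_y⟩⟨σ_zσ_t⟩ P[…]`, and `≤ 2 ⟨σ_xσ_yσ_zσ_t⟩ P[…]` given Griffiths II as a
  hypothesis), `.nonpos` (Lebowitz' inequality `U₄ ≤ 0` given Griffiths I as a hypothesis);
  bookkeeping `twoPoint_isingMeasure`, `nPoint_isingMeasure`.

## Sources

* [DC2016] H. Duminil-Copin, *Random currents expansion of the Ising model*, arXiv:1607.06933,
  §4.3 eq. (24) (p. 13; finite-volume laws `P^{a,b} = P^{a,b}_{Λ,β,h}` of Def. 3.2, used with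
  `⟨·⟩_{Λ,β,0}` in Cor. 4.5), and p. 10 (the `𝓕_A` identity). Bib key `DuminilCopin2016`.
* [ADC2021] M. Aizenman, H. Duminil-Copin, *Marginal triviality of the scaling limits of critical
  4D Ising and φ⁴₄ models*, Ann. of Math. 194 (2021), arXiv:1912.07973: Def. 3.1–3.2, Lemma 3.3
  (switching), (3.7)–(3.9) (p. 11), (3.10)–(3.12) (p. 12). Bib key `AizenmanDuminilCopinAnnals2021`.
* [Aiz1982] M. Aizenman, *Geometric analysis of φ⁴ fields and Ising models*, Comm. Math. Phys. 86
  (1982) — the original source (paywalled; WANTED logged; not read). Bib key `Aizenman1982`.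

## Design choices and wording risks

* Setting. DC2016 (24) is a finite-volume identity (laws of Def. 3.2 on the finite vertex set
  `Λ`; used with `⟨·⟩_{Λ,β,0}` in Cor. 4.5); ADC2021 print (3.7) in finite volume and (3.10)–(3.11)
  for the infinite-volume state at `β ≤ β_c` ("Combining (3.10) for the different values of the
  product of spin-spin correlations leads to (3.11)"). Only the **finite-graph, free-boundary,
  zero-field** statements are vendored, in the setting of `RandomCurrents.lean` (`Λ = univ` of a
  `Fintype V`); the infinite-volume versions need infinite-volume double-current measures, which
  `Literature` does not have (flagged by the grounder of `stmt-…-0636`).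
* The event. DC2016 (24) has `{x₁ ⟷ x₂, x₃, x₄ in n₁+n₂}` under `P^{x₁x₃} ⊗ P^{x₂x₄}`; ADC2021
  (3.11) has `{C_{n₁+n₂}(x) ∩ C_{n₁+n₂}(z) ≠ ∅}` under `P^{xy,zt}`. Clusters of one current
  configuration meet iff they coincide iff `x ⟷ z`; and `x ⟷ y`, `z ⟷ t` hold `P^{xy,zt}`-a.s.
  (a current with sources `{x,y}` contains a path from `x` to `y`). We state the event as
  `tracedConn G x z` and follow ADC's lettering `(x,y,z,t)`; DC's (24) is the same statement with
  `(x₁,x₃,x₂,x₄) = (x,y,z,t)`.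
* Sources of a pair are written `{x} ∆ {y}` (as in `switching_lemma_pair`), so coincident points
  are allowed; the identity stays true on diagonals (e.g. `x = y`: both sides equal
  `-2⟨σ_xσ_z⟩⟨σ_xσ_t⟩`, by (3.7)).
* `0 ≤ β` is required because `doubleCurrentMeasure` truncates negative weights. No connectivity
  / non-degeneracy hypothesis: if no current with sources `{x} ∆ {y}` exists the measure is the junk
  `0`, but then `⟨σ_xσ_y⟩ = 0` as well and `U₄ = 0` (the graph separates `{x,…}`), so both sides
  vanish; likewise for (3.7), stated in product (not ratio) form.
* (3.12) divides by `⟨σ_xσ_yσ_zσ_t⟩` using Griffiths II; (3.13)–(3.14) and the tree diagram bound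
  (ADC2021 (1.22)) need four independent currents / the infinite-volume state and Aizenman 1982
  (not held) — NOT vendored.
-/

noncomputable section

open MeasureTheory Finset
open scoped symmDiff

namespace Literature.Probability.LatticeModels

variable {V : Type*} [Fintype V] [DecidableEq V] (G : SimpleGraph V) [DecidableRel G.Adj]

/-! ### Bookkeeping: `Correlations` spelling versus `IsingModel` spelling -/

omit [Fintype V] [DecidableRel G.Adj] in
/-- `twoPoint (isingMeasure …) spinAt x y = ⟨σ_x σ_y⟩_{Λ;β,h}^{bc}` [folklore]. -/
@[simp] theorem twoPoint_isingMeasure [G.LocallyFinite] (Λ : Finset V) (β h : ℝ)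
    (bc : BoundaryCondition V) (x y : V) :
    twoPoint (isingMeasure G Λ β h bc) spinAt x y = isingTwoPoint G Λ β h bc x y := rfl

omit [Fintype V] [DecidableRel G.Adj] in
/-- `nPoint (isingMeasure …) spinAt x = ⟨∏ᵢ σ_{xᵢ}⟩_{Λ;β,h}^{bc}` [folklore]. -/
@[simp] theorem nPoint_isingMeasure [G.LocallyFinite] (Λ : Finset V) (β h : ℝ)
    (bc : BoundaryCondition V) {n : ℕ} (x : Fin n → V) :
    nPoint (isingMeasure G Λ β h bc) spinAt x = isingExpect G Λ β h bc (spinMonomial x) := rfl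

/-! ### The event `𝓕_B` -/

/-- The event `{n₁ + n₂ ∈ 𝓕_B}`: "there exists a sub-current `m ≤ n₁ + n₂` such that `∂m = B`"
(ADC2021, Def. 3.2 (iii): "For a set of vertices `B`, we denote by `𝓕_B` the set of `n`
satisfying that there exists a sub-current `m ≤ n` such that `∂m = B`").
[cite: AizenmanDuminilCopinAnnals2021, Def. 3.2] -/
def subcurrentEvent (B : Finset V) : Set (Current G × Current G) :=
  {p | ∃ m : Current G, m ≤ p.1 + p.2 ∧ m.sources = B}

/-- Membership in `subcurrentEvent`. [cite: AizenmanDuminilCopinAnnals2021, Def. 3.2] -/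
theorem mem_subcurrentEvent_iff (B : Finset V) (p : Current G × Current G) :
    p ∈ subcurrentEvent G B ↔ ∃ m : Current G, m ≤ p.1 + p.2 ∧ m.sources = B := Iff.rfl

/-- `𝓕_∅` is the sure event (take `m = 0`). [cite: AizenmanDuminilCopinAnnals2021, Def. 3.2] -/
theorem subcurrentEvent_empty : subcurrentEvent G ∅ = Set.univ := by
  ext p
  simp only [mem_subcurrentEvent_iff, Set.mem_univ, iff_true]
  refine ⟨0, bot_le, ?_⟩
  ext x
  simp [Current.sources, Current.degree]

/-- `𝓕_B` is measurable (every subset of the countable space of pairs of currents is).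
[cite: AizenmanDuminilCopinAnnals2021, Def. 3.2] -/
theorem measurableSet_subcurrentEvent (B : Finset V) : MeasurableSet (subcurrentEvent G B) :=
  (Set.to_countable _).measurableSet

/-! ### The named facts -/

/-- NAMED FACT — **source insertion** (Aizenman–Duminil-Copin 2021, eq. (3.7), finite volume:
"`⟨σ_A⟩_{Λ,β} ⟨σ_B⟩_{Λ,β} / ⟨σ_A σ_B⟩_{Λ,β} = P^{A∆B,∅}_{Λ,β}[n₁ + n₂ ∈ 𝓕_B]`", with
`P^{A₁,…,A_i}_{Λ,β} = P^{A₁} ⊗ ⋯ ⊗ P^{A_i}` the law of independent currents with the prescribed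
sources, (3.8)–(3.9); Duminil-Copin 2016, p. 10). Free boundary condition, zero field, finite
graph `G`, `β ≥ 0`; `σ_A σ_B = σ_{A ∆ B}`; product form (both sides vanish when
`⟨σ_{A∆B}⟩ = 0`). Users take `(h : isingCorr_mul_eq_doubleCurrent_subcurrent G)`.
[cite: AizenmanDuminilCopinAnnals2021, eq. (3.7)] -/
def isingCorr_mul_eq_doubleCurrent_subcurrent : Prop :=
  ∀ {β : ℝ} (_hβ : 0 ≤ β) (A B : Finset V),
    isingCorr G univ β 0 .free A * isingCorr G univ β 0 .free B =
      isingCorr G univ β 0 .free (A ∆ B) *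
        (doubleCurrentMeasure G β (A ∆ B) ∅).real (subcurrentEvent G B)

/-- NAMED FACT — **Ursell's four-point function via random currents** (Aizenman 1982;
Duminil-Copin 2016, eq. (24): "`U₄(x₁,x₂,x₃,x₄) = -2 ⟨σ_{x₁}σ_{x₃}⟩⟨σ_{x₂}σ_{x₄}⟩
P^{x₁,x₃} ⊗ P^{x₂,x₄}[x₁ ⟷ x₂, x₃, x₄ in n₁+n₂]`"; Aizenman–Duminil-Copin 2021, eq. (3.11):
"`U₄^β(x,y,z,t) = -2⟨σ_xσ_y⟩_β⟨σ_zσ_t⟩_β P^{xy,zt}_β[C_{n₁+n₂}(x) ∩ C_{n₁+n₂}(z) ≠ ∅]`"), where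
`U₄(x,y,z,t) = ⟨σ_xσ_yσ_zσ_t⟩ - ⟨σ_xσ_y⟩⟨σ_zσ_t⟩ - ⟨σ_xσ_z⟩⟨σ_yσ_t⟩ - ⟨σ_xσ_t⟩⟨σ_yσ_z⟩`
(ADC2021 (1.21); `connectedFour`). Finite graph `G`, free boundary condition, zero field,
`β ≥ 0`; the event is `{x ⟷ z in n₁ + n₂}` (equal to both printed events, see the module
docstring). Users take `(h : ursellFour_eq_doubleCurrent G)`.
[cite: DuminilCopin2016, eq. (24)] [cite: AizenmanDuminilCopinAnnals2021, eq. (3.11)] -/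
def ursellFour_eq_doubleCurrent : Prop :=
  ∀ {β : ℝ} (_hβ : 0 ≤ β) (x y z t : V),
    connectedFour (isingMeasure G univ β 0 .free) spinAt ![x, y, z, t] =
      -2 * isingTwoPoint G univ β 0 .free x y * isingTwoPoint G univ β 0 .free z t *
        (doubleCurrentMeasure G β ({x} ∆ {y}) ({z} ∆ {t})).real (tracedConn G x z)

/-! ### Corollaries (proved from the fact) -/

variable {G}

/-- `|U₄(x,y,z,t)| = 2 |⟨σ_xσ_y⟩| |⟨σ_zσ_t⟩| · P^{xy,zt}[x ⟷ z]` (absolute values of ADC2021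
(3.11)). [cite: AizenmanDuminilCopinAnnals2021, eq. (3.11)] -/
theorem ursellFour_eq_doubleCurrent.abs_eq (h : ursellFour_eq_doubleCurrent G) {β : ℝ}
    (hβ : 0 ≤ β) (x y z t : V) :
    |connectedFour (isingMeasure G univ β 0 .free) spinAt ![x, y, z, t]| =
      2 * |isingTwoPoint G univ β 0 .free x y| * |isingTwoPoint G univ β 0 .free z t| *
        (doubleCurrentMeasure G β ({x} ∆ {y}) ({z} ∆ {t})).real (tracedConn G x z) := by
  rw [h hβ, abs_mul, abs_mul, abs_mul, abs_of_nonneg (measureReal_nonneg (μ := _))]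
  norm_num

/-- ADC2021 (3.12)-type bound with the two-point prefactor:
`|U₄(x,y,z,t)| ≤ 2 ⟨σ_xσ_y⟩⟨σ_zσ_t⟩ · P^{xy,zt}[x ⟷ z]`, given `⟨σ_xσ_y⟩, ⟨σ_zσ_t⟩ ≥ 0`
(Griffiths I, fed as hypotheses). [cite: AizenmanDuminilCopinAnnals2021, eq. (3.12)] -/
theorem ursellFour_eq_doubleCurrent.abs_le (h : ursellFour_eq_doubleCurrent G) {β : ℝ}
    (hβ : 0 ≤ β) (x y z t : V) (hxy : 0 ≤ isingTwoPoint G univ β 0 .free x y)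
    (hzt : 0 ≤ isingTwoPoint G univ β 0 .free z t) :
    |connectedFour (isingMeasure G univ β 0 .free) spinAt ![x, y, z, t]| ≤
      2 * isingTwoPoint G univ β 0 .free x y * isingTwoPoint G univ β 0 .free z t *
        (doubleCurrentMeasure G β ({x} ∆ {y}) ({z} ∆ {t})).real (tracedConn G x z) := by
  rw [h.abs_eq hβ, abs_of_nonneg hxy, abs_of_nonneg hzt]

/-- ADC2021 (3.12): `|U₄(x,y,z,t)| ≤ 2 ⟨σ_xσ_yσ_zσ_t⟩ · P^{xy,zt}[x ⟷ z]`, given Griffiths I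
for the two pairs and Griffiths II `⟨σ_xσ_y⟩⟨σ_zσ_t⟩ ≤ ⟨σ_xσ_yσ_zσ_t⟩` (fed as hypotheses; the
printed form divides by `⟨σ_xσ_yσ_zσ_t⟩`). [cite: AizenmanDuminilCopinAnnals2021, eq. (3.12)] -/
theorem ursellFour_eq_doubleCurrent.abs_le_fourPoint (h : ursellFour_eq_doubleCurrent G) {β : ℝ}
    (hβ : 0 ≤ β) (x y z t : V) (hxy : 0 ≤ isingTwoPoint G univ β 0 .free x y)
    (hzt : 0 ≤ isingTwoPoint G univ β 0 .free z t)
    (hgks : isingTwoPoint G univ β 0 .free x y * isingTwoPoint G univ β 0 .free z t ≤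
      isingExpect G univ β 0 .free (spinMonomial ![x, y, z, t])) :
    |connectedFour (isingMeasure G univ β 0 .free) spinAt ![x, y, z, t]| ≤
      2 * isingExpect G univ β 0 .free (spinMonomial ![x, y, z, t]) *
        (doubleCurrentMeasure G β ({x} ∆ {y}) ({z} ∆ {t})).real (tracedConn G x z) := by
  refine (h.abs_le hβ x y z t hxy hzt).trans ?_
  have hP : 0 ≤ (doubleCurrentMeasure G β ({x} ∆ {y}) ({z} ∆ {t})).real (tracedConn G x z) :=
    measureReal_nonneg
  nlinarith

/-- **Lebowitz' inequality from the random-current identity**: `U₄(x,y,z,t) ≤ 0`, given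
`⟨σ_xσ_y⟩, ⟨σ_zσ_t⟩ ≥ 0` (Griffiths I, fed as hypotheses) (Duminil-Copin 2016, §4.3;
cf. `Literature.Probability.LatticeModels.lebowitz`). [cite: DuminilCopin2016, eq. (24)] -/
theorem ursellFour_eq_doubleCurrent.nonpos (h : ursellFour_eq_doubleCurrent G) {β : ℝ}
    (hβ : 0 ≤ β) (x y z t : V) (hxy : 0 ≤ isingTwoPoint G univ β 0 .free x y)
    (hzt : 0 ≤ isingTwoPoint G univ β 0 .free z t) :
    connectedFour (isingMeasure G univ β 0 .free) spinAt ![x, y, z, t] ≤ 0 := by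
  rw [h hβ]
  have hP : 0 ≤ (doubleCurrentMeasure G β ({x} ∆ {y}) ({z} ∆ {t})).real (tracedConn G x z) :=
    measureReal_nonneg
  have : 0 ≤ 2 * isingTwoPoint G univ β 0 .free x y * isingTwoPoint G univ β 0 .free z t *
      (doubleCurrentMeasure G β ({x} ∆ {y}) ({z} ∆ {t})).real (tracedConn G x z) := by
    positivity
  linarith

/-- Wick's rule holds exactly at `(x,y,z,t)` iff the prefactor vanishes or the two double-current
clusters almost surely do not meet: `U₄ = 0 ↔ ⟨σ_xσ_y⟩⟨σ_zσ_t⟩ = 0 ∨ P^{xy,zt}[x ⟷ z] = 0`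
(ADC2021, discussion after (3.11)). [cite: AizenmanDuminilCopinAnnals2021, eq. (3.11)] -/
theorem ursellFour_eq_doubleCurrent.eq_zero_iff (h : ursellFour_eq_doubleCurrent G) {β : ℝ}
    (hβ : 0 ≤ β) (x y z t : V) :
    connectedFour (isingMeasure G univ β 0 .free) spinAt ![x, y, z, t] = 0 ↔
      isingTwoPoint G univ β 0 .free x y * isingTwoPoint G univ β 0 .free z t = 0 ∨
        (doubleCurrentMeasure G β ({x} ∆ {y}) ({z} ∆ {t})).real (tracedConn G x z) = 0 := by
  rw [h hβ]
  constructor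
  · intro h0
    rcases mul_eq_zero.mp h0 with h1 | h1
    · left
      have : (-2 : ℝ) ≠ 0 := by norm_num
      rcases mul_eq_zero.mp h1 with h2 | h2
      · rcases mul_eq_zero.mp h2 with h3 | h3
        · exact absurd h3 this
        · simp [h3]
      · simp [h2]
    · exact Or.inr h1
  · rintro (h0 | h0)
    · have : -2 * isingTwoPoint G univ β 0 .free x y * isingTwoPoint G univ β 0 .free z t = 0 := by
        rw [mul_assoc, h0, mul_zero]
      rw [this, zero_mul]
    · rw [h0, mul_zero]


/-! ### The requested spelling: `doubleCurrentU4Identity` (item `defn-doubleCurrentU4Identity`)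

The planner of `stmt-CriticalPhenomena-0636` asked for the identity under the name
`doubleCurrentU4Identity`, with pair sources `{x, y}`, `{z, t}` for pairwise-distinct sites and
the event "the traced cluster of `x` in `n₁ + n₂` intersects the traced cluster of `z`"
(ADC2021 (3.11) verbatim). It is the fact `ursellFour_eq_doubleCurrent` above; we provide the
alias, the cluster-intersection event, its identification with `tracedConn G x z`, and the
printed spelling as a proved corollary. -/

variable (G)

/-- The event `{C_{n₁+n₂}(x) ∩ C_{n₁+n₂}(z) ≠ ∅}` of Aizenman–Duminil-Copin 2021, eq. (3.11):
some vertex `w` is connected to both `x` and `z` in the trace of `n₁ + n₂` ("the traced clusters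
of `x` and `z` intersect"). Equal to `tracedConn G x z` (`tracedClustersMeet_eq_tracedConn`).
[cite: AizenmanDuminilCopinAnnals2021, eq. (3.11)] -/
def tracedClustersMeet (x z : V) : Set (Current G × Current G) :=
  {p | ∃ w : V, p ∈ tracedConn G x w ∧ p ∈ tracedConn G z w}

omit [DecidableEq V] in
/-- Membership in `tracedClustersMeet`. [cite: AizenmanDuminilCopinAnnals2021, eq. (3.11)] -/
theorem mem_tracedClustersMeet_iff (x z : V) (p : Current G × Current G) :
    p ∈ tracedClustersMeet G x z ↔ ∃ w : V, p ∈ tracedConn G x w ∧ p ∈ tracedConn G z w :=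
  Iff.rfl

omit [DecidableEq V] in
/-- The clusters of `x` and `z` in one bond configuration meet iff `x ⟷ z` (connection is an
equivalence relation), so ADC2021's event (3.11) is `{x ⟷ z in n₁ + n₂}`. [folklore] -/
theorem tracedClustersMeet_eq_tracedConn (x z : V) :
    tracedClustersMeet G x z = tracedConn G x z := by
  ext p
  simp only [mem_tracedClustersMeet_iff, mem_tracedConn_iff]
  exact ⟨fun ⟨_, hx, hz⟩ => hx.trans hz.symm, fun h => ⟨z, h, SimpleGraph.Reachable.refl z⟩⟩

omit [DecidableEq V] in
/-- `tracedClustersMeet` is measurable. [folklore] -/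
theorem measurableSet_tracedClustersMeet (x z : V) :
    MeasurableSet (tracedClustersMeet G x z) :=
  (Set.to_countable _).measurableSet

/-- NAMED FACT (alias) — **the double-current identity for `U₄`**, requested name for
`ursellFour_eq_doubleCurrent G` (Aizenman 1982, Prop. 5.1; Aizenman–Duminil-Copin 2021,
eq. (3.11): "`U₄^β(x,y,z,t) = -2⟨σ_xσ_y⟩_β⟨σ_zσ_t⟩_β P^{xy,zt}_β[C_{n₁+n₂}(x) ∩ C_{n₁+n₂}(z) ≠ ∅]`").
Finite graph, free boundary condition, zero field, `β ≥ 0`. Users take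
`(h : doubleCurrentU4Identity G)`; the printed pair-source / cluster-intersection spelling for
distinct sites is `ursellFour_eq_doubleCurrent.eq_pair`.
[cite: AizenmanDuminilCopinAnnals2021, eq. (3.11)] [cite: DuminilCopin2016, eq. (24)] -/
abbrev doubleCurrentU4Identity : Prop := ursellFour_eq_doubleCurrent G

/-- `doubleCurrentU4Identity G` unfolds to `ursellFour_eq_doubleCurrent G`. [folklore] -/
theorem doubleCurrentU4Identity_iff :
    doubleCurrentU4Identity G ↔ ursellFour_eq_doubleCurrent G := Iff.rfl

variable {G}

/-- ADC2021 (3.11) in its printed spelling, for `x ≠ y` and `z ≠ t`: sources `{x, y}` and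
`{z, t}`, event "the traced clusters of `x` and `z` in `n₁ + n₂` intersect":
`U₄(x,y,z,t) = -2 ⟨σ_xσ_y⟩⟨σ_zσ_t⟩ · P^{{x,y},{z,t}}[C(x) ∩ C(z) ≠ ∅]`.
[cite: AizenmanDuminilCopinAnnals2021, eq. (3.11)] -/
theorem ursellFour_eq_doubleCurrent.eq_pair (h : ursellFour_eq_doubleCurrent G) {β : ℝ}
    (hβ : 0 ≤ β) {x y z t : V} (hxy : x ≠ y) (hzt : z ≠ t) :
    connectedFour (isingMeasure G univ β 0 .free) spinAt ![x, y, z, t] =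
      -2 * isingTwoPoint G univ β 0 .free x y * isingTwoPoint G univ β 0 .free z t *
        (doubleCurrentMeasure G β {x, y} {z, t}).real (tracedClustersMeet G x z) := by
  have hs : ∀ {a b : V}, a ≠ b → ({a} : Finset V) ∆ {b} = {a, b} := fun hab => by
    rw [Finset.symmDiff_eq_union (Finset.disjoint_singleton.mpr hab)]
    rfl
  rw [h hβ, tracedClustersMeet_eq_tracedConn, ← hs hxy, ← hs hzt]

end Literature.Probability.LatticeModels
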